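import Literature.AlgebraicGeometry.AbelianSchemes.TupleIsoAtOfFibreIso            -- ★ BRICK (T) §3–§4: `tupleRel_trans`, `tupleRel_baseChangeCompGrpIso_hom∕_inv`
import Literature.AlgebraicGeometry.AbelianSchemes.TupleRelBaseChangeUnique          -- ★ `tupleRel_baseChange_fst` (the canonical six-clause relation)
import Literature.AlgebraicGeometry.AbelianSchemes.PolarizedAbelianSchemeWithLevelBaseChangeCancel -- ★ `isBaseChangeVia_of_comp` (group schemes, level), `exists_comp_eq_of_comp`
import Literature.AlgebraicGeometry.AbelianSchemes.AbelianSchemeFixedPowBaseChange   -- ★ `RingAction.baseChange` (`baseChange_i` by `rfl`)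
import HarnessLib

/-!
# Six-clause pull-back relations of PEL tuples CANCEL; iterated versus single pull-back along `κ ≫ τ = ℓ`

Topic `AlgebraicGeometry/AbelianSchemes`; namespace `Literature.AlgebraicGeometry.AbelianSchemes.AbelianSchemeOver`.  THEOREMS ONLY (no definition,
no named fact, no instance, no notation, no `sorry`).  Cell hodgecm-mathlib (D-0151), P6 «MOD programme» (crux hLiu418 = stmt-HodgeConjecture-24832,
`--supports`, count-neutral), FILE 1∕2 of organ (GS-2-core) «STAGE TUPLE ⇒ EVERY `A`-ALGEBRA `T` WITH `t ∈ Tˣ`, WITH ITS GENERIC READING» (LEAD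
F0P6-plan (g3) 2026-09-02T01:09:11Z «=»; FILE 2∕2 = `AbelianSchemes/PELTupleStageLocalise`).  The UNBUNDLED six-clause currency (level ∕ `X`, `X̂`,
Poincaré, `λ`, `𝒪`-action) of ★ `TupleIsoAtOfFibreIso` (`tupleRel_trans`) and ★ `TupleRelBaseChangeUnique` (`tupleRel_baseChange_fst`), i.e. the cell
letters `tupleIsoAt` ∕ `TupleIsoVia` ∕ `TupleIsoAt₂` with a general base map.  HC_CM is proved only modulo the printed citations until rung 0 closes;
nothing here is about HC.

THE MATHEMATICS ([MumfordFogartyKirwan1994] Ch. 7 §2 Def. 7.2: `𝒜_{g,d,n}` is «a contravariant functor … in the obvious way» — pull-back of the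
triple `(X, λ, σ)`, values up to isomorphism; [GortzWedhorn2020] Prop. 4.16, (4.7): fibre products are unique up to unique isomorphism and
transitive, `X ×_S T ≅ (X ×_S S′) ×_{S′} T`).  Let tuples `(A, ι, (Â, 𝒫), λ, φ)` — abelian scheme, `𝒪`-action, dual pair, polarisation map, level
structure — be given.
* §1 ITERATED VERSUS SINGLE pull-back: for `κ : T → Y′`, `τ : Y′ → Y`, `ℓ : T → Y` with `κ ≫ τ = ℓ`, the tuples `(tuple ×_Y Y′) ×_{Y′} T` and
  `tuple ×_{Y,ℓ} T` satisfy the five clauses of MFK's «isomorphism of triples» along `𝟙 T` plus `𝒪`-equivariance, in BOTH directions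
  (`exists_tupleRel_baseChange_baseChange_of_comp_eq`, `exists_tupleRel_baseChange_of_comp_eq_baseChange_baseChange`: the comparison `(E, Ê)` of
  ★ `baseChangeCompGrpIso`, ★ BRICK (T) §4 `tupleRel_baseChangeCompGrpIso_hom∕_inv`, transported along `κ ≫ τ = ℓ`).
* §2 CANCELLATION (**`tupleRel_of_comp`**, `exists_tupleRel_of_comp`): a six-clause relation along `t ≫ f₂` (via `(G₁, Ĝ₁)`) and one along `f₂`
  (via `(G₂, Ĝ₂)`) into the same tuple yield one along `t` via the comparison maps `m`, `m̂` of the cartesian squares (`m ≫ G₂ = G₁`,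
  `m̂ ≫ Ĝ₂ = Ĝ₁`): level ∕ `X` and `X̂` by ★ `LevelStructure∕AbelianSchemeOver.isBaseChangeVia_of_comp`, Poincaré
  `(m × m̂)^*𝒫₂ ≅ (m × m̂)^*(G₂ × Ĝ₂)^*𝒫 = (G₁ × Ĝ₁)^*𝒫 ≅ 𝒫₁`, the `λ`- and `𝒪`-clauses as identities of maps into `Â ×_S T₂`, `A ×_S T₂`
  (after the projections) — the unbundled twin, WITH the `𝒪`-action, of ★ `PolarizedAbelianSchemeWithLevel.isBaseChangeVia_of_comp` (same proof).
* §3 FACTORISATION (`exists_tupleRel_baseChange_of_tupleRel_comp`): hence a relation along `m₀ ≫ s` factors through THE base change along `s`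
  (★ `AbelianSchemeOver∕RingAction∕DualPair∕Polarization∕LevelStructure.baseChange`, canonical relation ★ `tupleRel_baseChange_fst`).

## References
* [MumfordFogartyKirwan1994] D. Mumford, J. Fogarty, F. Kirwan, *Geometric Invariant Theory*, 3rd ed. (1994), Ch. 7 §2 Def. 7.2 (p. 129), Def. 7.3 (p. 130).
* [GortzWedhorn2020] U. Görtz, T. Wedhorn, *Algebraic Geometry I*, 2nd ed. (2020), Prop. 4.16 (p. 101), Section (4.7) (pp. 107–108).
-/

set_option autoImplicit false

noncomputable section

-- Mathlib's `Over`/pull-back API is stated across semireducible wrappers (as in the ★ `AbelianSchemes/*` files).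
set_option backward.isDefEq.respectTransparency false

universe u

open CategoryTheory CategoryTheory.Limits AlgebraicGeometry MonoidalCategory

/-! ### §1 Iterated versus single pull-back of a tuple along `κ′ ≫ τ = ℓ`: the five clauses along `𝟙 T`, both directions -/

namespace Literature.AlgebraicGeometry.AbelianSchemes

namespace AbelianSchemeOver

section CompEq

variable {Y Y' T : Scheme.{u}} (𝒜 : AbelianSchemeOver Y) {O : Type*} [CommRing O] (ρ : RingAction O 𝒜) (D : 𝒜.DualPair)
  (pol : 𝒜.Polarization D) {g n : ℕ} (lvl : 𝒜.LevelStructure g n) (τ : Y' ⟶ Y) (κ : T ⟶ Y') (ℓ : T ⟶ Y)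

/-- **ITERATED ⇒ SINGLE pull-back along `κ′ ≫ τ = ℓ`, as an isomorphism of MFK tuples along `𝟙 T`** ([MumfordFogartyKirwan1994] Def. 7.2
«in the obvious way»; [GortzWedhorn2020] (4.7)): for a tuple `(𝒜, ι, (Â, 𝒫), λ, φ)` over `Y` there are `H : (𝒜 ×_Y Y′) ×_{Y′} T → 𝒜 ×_{Y,ℓ} T`,
`Ĥ : (Â ×_Y Y′) ×_{Y′} T → Â ×_{Y,ℓ} T` with the five clauses along `𝟙 T` — level ∕ `X`, `X̂`, Poincaré `(H × Ĥ)^*𝒫_ℓ ≅ 𝒫″`, `λ″ ≫ Ĥ = H ≫ λ_ℓ`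
— and `𝒪`-equivariance `ι″(a) ≫ H = H ≫ ι_ℓ(a)` (`ι_f(a) = ι(a) ×_Y f`, ★ `RingAction.baseChange_i` by `rfl`).  `(H, Ĥ) = (E⁻¹, Ê⁻¹)` of ★
`baseChangeCompGrpIso` (★ `tupleRel_baseChangeCompGrpIso_inv`), transported along `κ′ ≫ τ = ℓ`.
[cite: MumfordFogartyKirwan1994, Ch. 7 §2 Definition 7.2 (p. 129)] [cite: GortzWedhorn2020, Section (4.7) (pp. 107–108)] -/
theorem exists_tupleRel_baseChange_baseChange_of_comp_eq (h : κ ≫ τ = ℓ) :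
    ∃ (H : ((𝒜.baseChange τ).baseChange κ).X.left ⟶ (𝒜.baseChange ℓ).X.left)
      (Ĥ : ((D.baseChange τ).baseChange κ).hat.X.left ⟶ (D.baseChange ℓ).hat.X.left),
      ((lvl.baseChange τ).baseChange κ).IsBaseChangeVia (lvl.baseChange ℓ) (𝟙 T) H ∧
      ((D.baseChange τ).baseChange κ).hat.IsBaseChangeVia (D.baseChange ℓ).hat (𝟙 T) Ĥ ∧
      (∃ (wG : ((𝒜.baseChange τ).baseChange κ).X.hom ≫ 𝟙 T = H ≫ (𝒜.baseChange ℓ).X.hom)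
          (wĜ : ((D.baseChange τ).baseChange κ).hat.X.hom ≫ 𝟙 T = Ĥ ≫ (D.baseChange ℓ).hat.X.hom),
        Nonempty ((Scheme.Modules.pullback
          (pullback.map ((𝒜.baseChange τ).baseChange κ).X.hom ((D.baseChange τ).baseChange κ).hat.X.hom
            (𝒜.baseChange ℓ).X.hom (D.baseChange ℓ).hat.X.hom H Ĥ (𝟙 T) wG wĜ)).obj (D.baseChange ℓ).P ≅
          ((D.baseChange τ).baseChange κ).P)) ∧
      ((pol.baseChange τ).baseChange κ).lam.left ≫ Ĥ = H ≫ (pol.baseChange ℓ).lam.left ∧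
      ∀ a : O, (baseChangeHom (baseChangeHom (ρ.i a) τ) κ).left ≫ H = H ≫ (baseChangeHom (ρ.i a) ℓ).left := by
  subst h
  exact ⟨_, _, tupleRel_baseChangeCompGrpIso_inv 𝒜 ρ D pol lvl τ κ⟩

/-- **SINGLE ⇒ ITERATED pull-back along `κ′ ≫ τ = ℓ`** (the inverse direction, `(H, Ĥ) = (E, Ê)` of ★ `baseChangeCompGrpIso`, ★
`tupleRel_baseChangeCompGrpIso_hom`): maps `𝒜 ×_{Y,ℓ} T → (𝒜 ×_Y Y′) ×_{Y′} T`, `Â ×_{Y,ℓ} T → (Â ×_Y Y′) ×_{Y′} T` with the five clauses along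
`𝟙 T` and `𝒪`-equivariance. [cite: MumfordFogartyKirwan1994, Ch. 7 §2 Definition 7.2 (p. 129)] [cite: GortzWedhorn2020, Section (4.7) (pp. 107–108)] -/
theorem exists_tupleRel_baseChange_of_comp_eq_baseChange_baseChange (h : κ ≫ τ = ℓ) :
    ∃ (H : (𝒜.baseChange ℓ).X.left ⟶ ((𝒜.baseChange τ).baseChange κ).X.left)
      (Ĥ : (D.baseChange ℓ).hat.X.left ⟶ ((D.baseChange τ).baseChange κ).hat.X.left),
      (lvl.baseChange ℓ).IsBaseChangeVia ((lvl.baseChange τ).baseChange κ) (𝟙 T) H ∧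
      (D.baseChange ℓ).hat.IsBaseChangeVia ((D.baseChange τ).baseChange κ).hat (𝟙 T) Ĥ ∧
      (∃ (wG : (𝒜.baseChange ℓ).X.hom ≫ 𝟙 T = H ≫ ((𝒜.baseChange τ).baseChange κ).X.hom)
          (wĜ : (D.baseChange ℓ).hat.X.hom ≫ 𝟙 T = Ĥ ≫ ((D.baseChange τ).baseChange κ).hat.X.hom),
        Nonempty ((Scheme.Modules.pullback
          (pullback.map (𝒜.baseChange ℓ).X.hom (D.baseChange ℓ).hat.X.hom ((𝒜.baseChange τ).baseChange κ).X.hom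
            ((D.baseChange τ).baseChange κ).hat.X.hom H Ĥ (𝟙 T) wG wĜ)).obj ((D.baseChange τ).baseChange κ).P ≅
          (D.baseChange ℓ).P)) ∧
      (pol.baseChange ℓ).lam.left ≫ Ĥ = H ≫ ((pol.baseChange τ).baseChange κ).lam.left ∧
      ∀ a : O, (baseChangeHom (ρ.i a) ℓ).left ≫ H = H ≫ (baseChangeHom (baseChangeHom (ρ.i a) τ) κ).left := by
  subst h
  exact ⟨_, _, tupleRel_baseChangeCompGrpIso_hom 𝒜 ρ D pol lvl τ κ⟩

end CompEq

/-! ### §2 Six-clause pull-back relations CANCEL: a relation along `t ≫ f₂` factors through one along `f₂` by one along `t`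
(the unbundled twin, WITH the `𝒪`-action, of ★ `PolarizedAbelianSchemeWithLevel.isBaseChangeVia_of_comp`) -/

section Cancel

variable {S T₁ T₂ : Scheme.{u}} {A : AbelianSchemeOver S} {A₁ : AbelianSchemeOver T₁} {A₂ : AbelianSchemeOver T₂}
  {D : A.DualPair} {D₁ : A₁.DualPair} {D₂ : A₂.DualPair}
  {lam : A.X ⟶ D.hat.X} {lam₁ : A₁.X ⟶ D₁.hat.X} {lam₂ : A₂.X ⟶ D₂.hat.X}
  {g n : ℕ} {φ : A.LevelStructure g n} {φ₁ : A₁.LevelStructure g n} {φ₂ : A₂.LevelStructure g n}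
  {O : Type*} {act : O → (A.X ⟶ A.X)} {act₁ : O → (A₁.X ⟶ A₁.X)} {act₂ : O → (A₂.X ⟶ A₂.X)}
  {f₂ : T₂ ⟶ S} {t : T₁ ⟶ T₂} {G₁ : A₁.X.left ⟶ A.X.left} {Ĝ₁ : D₁.hat.X.left ⟶ D.hat.X.left}
  {G₂ : A₂.X.left ⟶ A.X.left} {Ĝ₂ : D₂.hat.X.left ⟶ D.hat.X.left}

/-- **SIX-CLAUSE PULL-BACK RELATIONS OF TUPLES CANCEL** ([MumfordFogartyKirwan1994] Def. 7.2: `𝒜(t ≫ f₂) = 𝒜(t) ∘ 𝒜(f₂)` on the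
relation, for tuples with an `𝒪`-action): if `(G₂, Ĝ₂)` exhibits the tuple `(A₂, ι₂, (Â₂, 𝒫₂), λ₂, φ₂)` over `T₂` as the pull-back of
`(A, ι, (Â, 𝒫), λ, φ)` over `S` along `f₂`, `(G₁, Ĝ₁)` exhibits `(A₁, …)` over `T₁` as the pull-back along `t ≫ f₂`, and `m : A₁ → A₂`, `m̂ : Â₁ → Â₂`
are the comparison maps (`m ≫ G₂ = G₁`, `m̂ ≫ Ĝ₂ = Ĝ₁`, both over `t`; they exist, ★ `IsBaseChangeVia.exists_comp_eq_of_comp`), then `(m, m̂)`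
exhibits `(A₁, …)` as the pull-back of `(A₂, …)` along `t`: level ∕ `X` and `X̂` by ★ `LevelStructure∕AbelianSchemeOver.isBaseChangeVia_of_comp`,
Poincaré `(m × m̂)^*𝒫₂ ≅ (m × m̂)^*(G₂ × Ĝ₂)^*𝒫 ≅ (G₁ × Ĝ₁)^*𝒫 ≅ 𝒫₁`, and the `λ`- and `𝒪`-clauses read inside the pull-backs `Â₂ = Â ×_S T₂`,
`A₂ = A ×_S T₂` (after `Ĝ₂`∕`G₂` and over `T₂`). [cite: MumfordFogartyKirwan1994, Ch. 7 §2 Definition 7.2 (p. 129)]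
[cite: GortzWedhorn2020, Prop. 4.16 (p. 101) and Section (4.7) (pp. 107–108)] -/
theorem tupleRel_of_comp
    (h₁ : φ₁.IsBaseChangeVia φ (t ≫ f₂) G₁ ∧ D₁.hat.IsBaseChangeVia D.hat (t ≫ f₂) Ĝ₁ ∧
      (∃ (wG : A₁.X.hom ≫ t ≫ f₂ = G₁ ≫ A.X.hom) (wĜ : D₁.hat.X.hom ≫ t ≫ f₂ = Ĝ₁ ≫ D.hat.X.hom),
        Nonempty ((Scheme.Modules.pullback
          (pullback.map A₁.X.hom D₁.hat.X.hom A.X.hom D.hat.X.hom G₁ Ĝ₁ (t ≫ f₂) wG wĜ)).obj D.P ≅ D₁.P)) ∧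
      lam₁.left ≫ Ĝ₁ = G₁ ≫ lam.left ∧ ∀ a : O, (act₁ a).left ≫ G₁ = G₁ ≫ (act a).left)
    (h₂ : φ₂.IsBaseChangeVia φ f₂ G₂ ∧ D₂.hat.IsBaseChangeVia D.hat f₂ Ĝ₂ ∧
      (∃ (wG : A₂.X.hom ≫ f₂ = G₂ ≫ A.X.hom) (wĜ : D₂.hat.X.hom ≫ f₂ = Ĝ₂ ≫ D.hat.X.hom),
        Nonempty ((Scheme.Modules.pullback
          (pullback.map A₂.X.hom D₂.hat.X.hom A.X.hom D.hat.X.hom G₂ Ĝ₂ f₂ wG wĜ)).obj D.P ≅ D₂.P)) ∧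
      lam₂.left ≫ Ĝ₂ = G₂ ≫ lam.left ∧ ∀ a : O, (act₂ a).left ≫ G₂ = G₂ ≫ (act a).left)
    (m : A₁.X.left ⟶ A₂.X.left) (mh : D₁.hat.X.left ⟶ D₂.hat.X.left) (hmG : m ≫ G₂ = G₁)
    (hmπ : m ≫ A₂.X.hom = A₁.X.hom ≫ t) (hmhG : mh ≫ Ĝ₂ = Ĝ₁) (hmhπ : mh ≫ D₂.hat.X.hom = D₁.hat.X.hom ≫ t) :
    φ₁.IsBaseChangeVia φ₂ t m ∧ D₁.hat.IsBaseChangeVia D₂.hat t mh ∧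
      (∃ (wG : A₁.X.hom ≫ t = m ≫ A₂.X.hom) (wĜ : D₁.hat.X.hom ≫ t = mh ≫ D₂.hat.X.hom),
        Nonempty ((Scheme.Modules.pullback
          (pullback.map A₁.X.hom D₁.hat.X.hom A₂.X.hom D₂.hat.X.hom m mh t wG wĜ)).obj D₂.P ≅ D₁.P)) ∧
      lam₁.left ≫ mh = m ≫ lam₂.left ∧ ∀ a : O, (act₁ a).left ≫ m = m ≫ (act₂ a).left := by
  obtain ⟨hl₁, hh₁, ⟨wG₁, wĜ₁, ⟨e₁⟩⟩, hlam₁, hact₁⟩ := h₁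
  obtain ⟨hl₂, hh₂, ⟨wG₂, wĜ₂, ⟨e₂⟩⟩, hlam₂, hact₂⟩ := h₂
  obtain ⟨-, hpb₂, -, -⟩ := id hl₂.1
  obtain ⟨-, hpbh₂, -, -⟩ := id hh₂
  refine ⟨LevelStructure.isBaseChangeVia_of_comp hl₁ hl₂ m hmG hmπ,
    AbelianSchemeOver.isBaseChangeVia_of_comp hh₁ hh₂ mh hmhG hmhπ, ⟨hmπ.symm, hmhπ.symm, ⟨?_⟩⟩, ?_, fun a => ?_⟩
  · -- Poincaré: `(m × m̂)^*𝒫₂ ≅ (m × m̂)^*(G₂ × Ĝ₂)^*𝒫 ≅ ((m × m̂) ≫ (G₂ × Ĝ₂))^*𝒫 = (G₁ × Ĝ₁)^*𝒫 ≅ 𝒫₁`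
    have hcomp : pullback.map A₁.X.hom D₁.hat.X.hom A₂.X.hom D₂.hat.X.hom m mh t hmπ.symm hmhπ.symm ≫
          pullback.map A₂.X.hom D₂.hat.X.hom A.X.hom D.hat.X.hom G₂ Ĝ₂ f₂ wG₂ wĜ₂ =
        pullback.map A₁.X.hom D₁.hat.X.hom A.X.hom D.hat.X.hom G₁ Ĝ₁ (t ≫ f₂) wG₁ wĜ₁ := by
      apply pullback.hom_ext
      · rw [Category.assoc, pullback.lift_fst, ← Category.assoc, pullback.lift_fst, Category.assoc, hmG,
          pullback.lift_fst]
      · rw [Category.assoc, pullback.lift_snd, ← Category.assoc, pullback.lift_snd, Category.assoc, hmhG,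
          pullback.lift_snd]
    exact (Scheme.Modules.pullback
        (pullback.map A₁.X.hom D₁.hat.X.hom A₂.X.hom D₂.hat.X.hom m mh t hmπ.symm hmhπ.symm)).mapIso e₂.symm ≪≫
      (Scheme.Modules.pullbackComp
        (pullback.map A₁.X.hom D₁.hat.X.hom A₂.X.hom D₂.hat.X.hom m mh t hmπ.symm hmhπ.symm)
        (pullback.map A₂.X.hom D₂.hat.X.hom A.X.hom D.hat.X.hom G₂ Ĝ₂ f₂ wG₂ wĜ₂)).app D.P ≪≫
      (Scheme.Modules.pullbackCongr hcomp).app D.P ≪≫ e₁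
  · -- `λ`: compare after `Ĝ₂` and over `T₂`, i.e. as maps into `Â₂ = Â ×_S T₂`
    apply hpbh₂.hom_ext
    · rw [Category.assoc, hmhG, hlam₁, Category.assoc, hlam₂, ← Category.assoc, hmG]
    · rw [Category.assoc, hmhπ, ← Category.assoc, Over.w lam₁, Category.assoc, Over.w lam₂, hmπ]
  · -- `𝒪`-action: compare after `G₂` and over `T₂`, i.e. as maps into `A₂ = A ×_S T₂`
    apply hpb₂.hom_ext
    · rw [Category.assoc, hmG, hact₁ a, Category.assoc, hact₂ a, ← Category.assoc, hmG]
    · rw [Category.assoc, hmπ, ← Category.assoc, Over.w (act₁ a), Category.assoc, Over.w (act₂ a), hmπ]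

/-- **Existence form of the cancellation**: the comparison maps exist (lifts through the cartesian squares of `(A₂, Â₂)`, ★
`IsBaseChangeVia.exists_comp_eq_of_comp`), so a six-clause relation along `t ≫ f₂` and one along `f₂` into the same tuple yield a six-clause
relation along `t`, by maps `m`, `m̂` with `m ≫ G₂ = G₁`, `m̂ ≫ Ĝ₂ = Ĝ₁`. [cite: MumfordFogartyKirwan1994, Ch. 7 §2 Definition 7.2 (p. 129)]
[cite: GortzWedhorn2020, Prop. 4.16 (p. 101)] -/
theorem exists_tupleRel_of_comp
    (h₁ : φ₁.IsBaseChangeVia φ (t ≫ f₂) G₁ ∧ D₁.hat.IsBaseChangeVia D.hat (t ≫ f₂) Ĝ₁ ∧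
      (∃ (wG : A₁.X.hom ≫ t ≫ f₂ = G₁ ≫ A.X.hom) (wĜ : D₁.hat.X.hom ≫ t ≫ f₂ = Ĝ₁ ≫ D.hat.X.hom),
        Nonempty ((Scheme.Modules.pullback
          (pullback.map A₁.X.hom D₁.hat.X.hom A.X.hom D.hat.X.hom G₁ Ĝ₁ (t ≫ f₂) wG wĜ)).obj D.P ≅ D₁.P)) ∧
      lam₁.left ≫ Ĝ₁ = G₁ ≫ lam.left ∧ ∀ a : O, (act₁ a).left ≫ G₁ = G₁ ≫ (act a).left)
    (h₂ : φ₂.IsBaseChangeVia φ f₂ G₂ ∧ D₂.hat.IsBaseChangeVia D.hat f₂ Ĝ₂ ∧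
      (∃ (wG : A₂.X.hom ≫ f₂ = G₂ ≫ A.X.hom) (wĜ : D₂.hat.X.hom ≫ f₂ = Ĝ₂ ≫ D.hat.X.hom),
        Nonempty ((Scheme.Modules.pullback
          (pullback.map A₂.X.hom D₂.hat.X.hom A.X.hom D.hat.X.hom G₂ Ĝ₂ f₂ wG wĜ)).obj D.P ≅ D₂.P)) ∧
      lam₂.left ≫ Ĝ₂ = G₂ ≫ lam.left ∧ ∀ a : O, (act₂ a).left ≫ G₂ = G₂ ≫ (act a).left) :
    ∃ (m : A₁.X.left ⟶ A₂.X.left) (mh : D₁.hat.X.left ⟶ D₂.hat.X.left), m ≫ G₂ = G₁ ∧ mh ≫ Ĝ₂ = Ĝ₁ ∧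
      (φ₁.IsBaseChangeVia φ₂ t m ∧ D₁.hat.IsBaseChangeVia D₂.hat t mh ∧
        (∃ (wG : A₁.X.hom ≫ t = m ≫ A₂.X.hom) (wĜ : D₁.hat.X.hom ≫ t = mh ≫ D₂.hat.X.hom),
          Nonempty ((Scheme.Modules.pullback
            (pullback.map A₁.X.hom D₁.hat.X.hom A₂.X.hom D₂.hat.X.hom m mh t wG wĜ)).obj D₂.P ≅ D₁.P)) ∧
        lam₁.left ≫ mh = m ≫ lam₂.left ∧ ∀ a : O, (act₁ a).left ≫ m = m ≫ (act₂ a).left) := by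
  obtain ⟨m, hmG, hmπ⟩ := h₁.1.1.exists_comp_eq_of_comp h₂.1.1
  obtain ⟨mh, hmhG, hmhπ⟩ := h₁.2.1.exists_comp_eq_of_comp h₂.2.1
  exact ⟨m, mh, hmG, hmhG, tupleRel_of_comp h₁ h₂ m mh hmG hmπ hmhG hmhπ⟩

end Cancel

/-! ### §3 A pull-back relation along `m₀ ≫ s` factors through THE base change along `s` -/

section Factor

variable {Y Y' Z : Scheme.{u}} (𝒜 : AbelianSchemeOver Y) {O : Type*} [CommRing O] (ρ : RingAction O 𝒜) (D : 𝒜.DualPair)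
  (pol : 𝒜.Polarization D) {g n : ℕ} (lvl : 𝒜.LevelStructure g n) (s : Y' ⟶ Y) (m₀ : Z ⟶ Y')
  {𝒜Z : AbelianSchemeOver Z} {DZ : 𝒜Z.DualPair} {lamZ : 𝒜Z.X ⟶ DZ.hat.X} {φZ : 𝒜Z.LevelStructure g n}
  {actZ : O → (𝒜Z.X ⟶ 𝒜Z.X)} {G : 𝒜Z.X.left ⟶ 𝒜.X.left} {Ĝ : DZ.hat.X.left ⟶ D.hat.X.left}

/-- **A SIX-CLAUSE PULL-BACK RELATION ALONG `m₀ ≫ s` FACTORS THROUGH THE BASE CHANGE ALONG `s`** ([MumfordFogartyKirwan1994] Def. 7.2): if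
`(G, Ĝ)` exhibits a tuple `(A_Z, ι_Z, (Â_Z, 𝒫_Z), λ_Z, φ_Z)` over `Z` as the pull-back of `(𝒜, ι, (Â, 𝒫), λ, φ)` over `Y` along `m₀ ≫ s`, then
some `(G′, Ĝ′)` with `G′ ≫ pr₁ = G`, `Ĝ′ ≫ pr₁ = Ĝ` exhibits it as the pull-back along `m₀` of THE base change
`(𝒜 ×_Y Y′, ι ×_Y Y′, (Â ×_Y Y′, 𝒫_{Y′}), λ_{Y′}, φ_{Y′})` (★ `AbelianSchemeOver∕RingAction∕DualPair∕Polarization∕LevelStructure.baseChange`) —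
§2 cancellation against the canonical relation ★ `tupleRel_baseChange_fst`. [cite: MumfordFogartyKirwan1994, Ch. 7 §2 Definition 7.2 (p. 129)]
[cite: GortzWedhorn2020, Prop. 4.16 (p. 101) and Section (4.7) (pp. 107–108)] -/
theorem exists_tupleRel_baseChange_of_tupleRel_comp
    (h : φZ.IsBaseChangeVia lvl (m₀ ≫ s) G ∧ DZ.hat.IsBaseChangeVia D.hat (m₀ ≫ s) Ĝ ∧
      (∃ (wG : 𝒜Z.X.hom ≫ m₀ ≫ s = G ≫ 𝒜.X.hom) (wĜ : DZ.hat.X.hom ≫ m₀ ≫ s = Ĝ ≫ D.hat.X.hom),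
        Nonempty ((Scheme.Modules.pullback
          (pullback.map 𝒜Z.X.hom DZ.hat.X.hom 𝒜.X.hom D.hat.X.hom G Ĝ (m₀ ≫ s) wG wĜ)).obj D.P ≅ DZ.P)) ∧
      lamZ.left ≫ Ĝ = G ≫ pol.lam.left ∧ ∀ a : O, (actZ a).left ≫ G = G ≫ (ρ.i a).left) :
    ∃ (G' : 𝒜Z.X.left ⟶ (𝒜.baseChange s).X.left) (Ĝ' : DZ.hat.X.left ⟶ (D.baseChange s).hat.X.left),
      G' ≫ pullback.fst 𝒜.X.hom s = G ∧ Ĝ' ≫ pullback.fst D.hat.X.hom s = Ĝ ∧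
      (φZ.IsBaseChangeVia (lvl.baseChange s) m₀ G' ∧ DZ.hat.IsBaseChangeVia (D.baseChange s).hat m₀ Ĝ' ∧
        (∃ (wG : 𝒜Z.X.hom ≫ m₀ = G' ≫ (𝒜.baseChange s).X.hom) (wĜ : DZ.hat.X.hom ≫ m₀ = Ĝ' ≫ (D.baseChange s).hat.X.hom),
          Nonempty ((Scheme.Modules.pullback
            (pullback.map 𝒜Z.X.hom DZ.hat.X.hom (𝒜.baseChange s).X.hom (D.baseChange s).hat.X.hom G' Ĝ' m₀ wG wĜ)).obj
              (D.baseChange s).P ≅ DZ.P)) ∧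
        lamZ.left ≫ Ĝ' = G' ≫ (pol.baseChange s).lam.left ∧
        ∀ a : O, (actZ a).left ≫ G' = G' ≫ (baseChangeHom (ρ.i a) s).left) :=
  exists_tupleRel_of_comp h (tupleRel_baseChange_fst 𝒜 ρ D pol lvl s)

end Factor

end AbelianSchemeOver

end Literature.AlgebraicGeometry.AbelianSchemes

end
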